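import Mathlib

/-!
# Stub `stub_caseII_expandCoprime` (line `eac-extends-core-automorphisms`, crux stmt-Schanuel-0968)

**Relatively prime multivariate polynomials stay relatively prime under `X_i ↦ X_i ^ e`.**

Let `k` be a field, `e > 0`, and let `φ := MvPolynomial.expand e` be the `k`-algebra
endomorphism `X_i ↦ X_i ^ e` of `S := k[X_1, …, X_p]`.  If `P` and `Q` are relatively prime
(every common divisor is a unit), then so are `φ P` and `φ Q`.  Inside `stub_caseII_core`
this keeps the fraction `ev_N(P) / ev_N(Q)` in lowest terms when the level `N` is replaced by
`N * e`.

## Proof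

The ring `S` is a free module over the subring `φ(S) = k[X_1^e, …, X_p^e]` with basis the
monomials `X^r`, `0 ≤ r_i < e`; we only use the resulting *residue-class decomposition*:
for `r : σ →₀ ℕ` the part of `F ∈ S` supported on the exponents `n` with `n_i % e = r_i`
for all `i` has the form `X^r * φ F₀` (`expandCoprime_proj`), and multiplication by `φ a`
commutes with taking this part (`expandCoprime_coeff_expand_mul`), because the exponents of
`φ a` are divisible by `e`.

In the unique factorisation domain `S`, `IsRelPrime a b` gives `a ∣ b * v → a ∣ v`
(`IsRelPrime.dvd_of_dvd_mul_left`).  This transfers to `φ a, φ b`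
(`expandCoprime_expand_dvd`): if `φ b * W = φ a * H`, compare residue-class parts,
cancel `X^r`, use injectivity of `φ` to get `b * W₀ = a * H₀`, hence `a ∣ W₀` and
`φ a ∣ X^r * φ W₀`; summing over the finitely many residue classes of `W` gives `φ a ∣ W`.
Finally, for `α ≠ 0` in a domain, `(∀ W, α ∣ β * W → α ∣ W)` implies `IsRelPrime α β`
(`expandCoprime_isRelPrime_of_forall_dvd`); the case `P = 0` is the statement that `φ`
preserves units.  The hypotheses `IsAlgClosed k`, `CharZero k` of the registered signature
are not needed.
-/

-- `Summit.Schanuel.Schanuel.…` is the single-problem-summit namespace by design (D-0017).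
set_option linter.dupNamespace false

namespace Summit.Schanuel.Schanuel.Theorems.RigidCore

open MvPolynomial

section Helpers

variable {σ R : Type*} [CommSemiring R] [DecidableEq σ]

/-- **Residue-class part of a polynomial.**  For `r : σ →₀ ℕ`, the part of `F` supported on
the exponents `n` with `n i % e = r i` for all `i` is of the form `X^r * expand e G₀`. -/
theorem expandCoprime_proj (e : ℕ) (r : σ →₀ ℕ) (F : MvPolynomial σ R) :
    ∃ G₀ : MvPolynomial σ R, ∀ n : σ →₀ ℕ, coeff n (monomial r 1 * expand e G₀) =
      if Finsupp.mapRange (· % e) (Nat.zero_mod e) n = r then coeff n F else 0 := by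
  refine ⟨∑ m ∈ F.support with Finsupp.mapRange (· % e) (Nat.zero_mod e) m = r,
    monomial (Finsupp.mapRange (· / e) (Nat.zero_div e) m) (coeff m F), fun n => ?_⟩
  have key : monomial r (1 : R) * expand e
      (∑ m ∈ F.support with Finsupp.mapRange (· % e) (Nat.zero_mod e) m = r,
        monomial (Finsupp.mapRange (· / e) (Nat.zero_div e) m) (coeff m F)) =
      ∑ m ∈ F.support with Finsupp.mapRange (· % e) (Nat.zero_mod e) m = r,
        monomial m (coeff m F) := by
    rw [map_sum, Finset.mul_sum]
    refine Finset.sum_congr rfl fun m hm => ?_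
    have hrm : r + e • Finsupp.mapRange (· / e) (Nat.zero_div e) m = m := by
      ext i
      have hi : m i % e = r i := by
        simpa using DFunLike.congr_fun (Finset.mem_filter.mp hm).2 i
      simp only [Finsupp.coe_add, Pi.add_apply, Finsupp.coe_smul, Pi.smul_apply,
        Finsupp.mapRange_apply, smul_eq_mul]
      rw [← hi]
      exact Nat.mod_add_div (m i) e
    rw [expand_monomial, monomial_mul, one_mul, hrm]
  rw [key, coeff_sum]
  simp_rw [coeff_monomial]
  rw [Finset.sum_ite_eq']
  by_cases h2 : Finsupp.mapRange (· % e) (Nat.zero_mod e) n = r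
  · rw [if_pos h2]
    by_cases h1 : n ∈ F.support
    · rw [if_pos (Finset.mem_filter.mpr ⟨h1, h2⟩)]
    · rw [if_neg (fun h => h1 (Finset.mem_filter.mp h).1), notMem_support_iff.mp h1]
  · have h1 : n ∉ F.support.filter
        (fun m => Finsupp.mapRange (· % e) (Nat.zero_mod e) m = r) :=
      fun h => h2 (Finset.mem_filter.mp h).2
    rw [if_neg h2, if_neg h1]

/-- **Multiplication by `expand e a` commutes with taking residue-class parts.**  If `G` is
the `r`-part of `F`, then `expand e a * G` is the `r`-part of `expand e a * F`: the
exponents of `expand e a` are divisible by `e`. -/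
theorem expandCoprime_coeff_expand_mul (e : ℕ) (r : σ →₀ ℕ) (a F G : MvPolynomial σ R)
    (hG : ∀ n : σ →₀ ℕ, coeff n G =
      if Finsupp.mapRange (· % e) (Nat.zero_mod e) n = r then coeff n F else 0)
    (n : σ →₀ ℕ) :
    coeff n (expand e a * G) =
      if Finsupp.mapRange (· % e) (Nat.zero_mod e) n = r then coeff n (expand e a * F)
      else 0 := by
  rw [coeff_mul, coeff_mul]
  have key : ∀ x ∈ Finset.HasAntidiagonal.antidiagonal n, coeff x.1 (expand e a) * coeff x.2 G =
      if Finsupp.mapRange (· % e) (Nat.zero_mod e) n = r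
      then coeff x.1 (expand e a) * coeff x.2 F else 0 := by
    intro x hx
    rw [hG]
    by_cases h0 : coeff x.1 (expand e a) = 0
    · simp [h0]
    have hdvd : ∀ i, e ∣ x.1 i := fun i => by
      by_contra hne
      exact h0 (coeff_expand_of_not_dvd a hne)
    have heq : Finsupp.mapRange (· % e) (Nat.zero_mod e) x.2 =
        Finsupp.mapRange (· % e) (Nat.zero_mod e) n := by
      ext i
      obtain ⟨c, hc⟩ := hdvd i
      have hn : n i = x.1 i + x.2 i := by
        rw [← Finsupp.add_apply, Finset.HasAntidiagonal.mem_antidiagonal.mp hx]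
      simp only [Finsupp.mapRange_apply]
      rw [hn, hc, Nat.mul_add_mod]
    rw [heq]
    split_ifs <;> simp
  rw [Finset.sum_congr rfl key]
  split_ifs
  · rfl
  · exact Finset.sum_const_zero

end Helpers

/-- **Transfer of `a ∣ b * v → a ∣ v` along `expand e`.**  Over a domain, if `a` is
"regular modulo `b`" in the sense `∀ v, a ∣ b * v → a ∣ v`, then so is `expand e a` with
respect to `expand e b` (`e > 0`): compare residue-class parts, cancel `X^r`, and use the
injectivity of `expand e`. -/
theorem expandCoprime_expand_dvd {σ R : Type*} [CommRing R] [IsDomain R] {e : ℕ} (he : 0 < e)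
    {a b : MvPolynomial σ R} (hab : ∀ v, a ∣ b * v → a ∣ v) (W : MvPolynomial σ R)
    (hW : expand e a ∣ expand e b * W) : expand e a ∣ W := by
  classical
  obtain ⟨H, hH⟩ := hW
  set ρ : (σ →₀ ℕ) → (σ →₀ ℕ) := fun n => Finsupp.mapRange (· % e) (Nat.zero_mod e) n with hρ
  -- Step 1: each residue-class part of `W` is divisible by `expand e a`.
  have step : ∀ r : σ →₀ ℕ, ∃ K : MvPolynomial σ R, ∀ n : σ →₀ ℕ,
      coeff n (expand e a * K) = if ρ n = r then coeff n W else 0 := by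
    intro r
    obtain ⟨W₀, hW₀⟩ := expandCoprime_proj e r W
    obtain ⟨H₀, hH₀⟩ := expandCoprime_proj e r H
    have h1 : expand e b * (monomial r 1 * expand e W₀) =
        expand e a * (monomial r 1 * expand e H₀) := by
      ext n
      rw [expandCoprime_coeff_expand_mul e r b W _ hW₀ n,
        expandCoprime_coeff_expand_mul e r a H _ hH₀ n, hH]
    rw [mul_left_comm, mul_left_comm (expand e a), ← map_mul, ← map_mul] at h1
    have hm : (monomial r (1 : R) : MvPolynomial σ R) ≠ 0 := by simp [monomial_eq_zero]
    have h2 : b * W₀ = a * H₀ := expand_injective he (mul_left_cancel₀ hm h1)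
    obtain ⟨K₀, hK₀⟩ := hab W₀ ⟨H₀, h2⟩
    refine ⟨monomial r 1 * expand e K₀, fun n => ?_⟩
    rw [← hW₀ n, hK₀, map_mul]
    congr 1
    ring
  -- Step 2: sum over the finitely many residue classes of `W`.
  choose K hK using step
  refine ⟨∑ r ∈ W.support.image ρ, K r, ?_⟩
  rw [Finset.mul_sum]
  ext n
  rw [coeff_sum]
  simp only [hK]
  rw [Finset.sum_ite_eq]
  split_ifs with h
  · rfl
  · exact notMem_support_iff.mp fun hn => h (Finset.mem_image_of_mem ρ hn)

/-- **Regular modulo `β` implies relatively prime.**  In a domain, if `α ≠ 0` and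
`α ∣ β * W → α ∣ W` for all `W`, then every common divisor of `α` and `β` is a unit. -/
theorem expandCoprime_isRelPrime_of_forall_dvd {M : Type*} [CommRing M] [IsDomain M]
    {α β : M} (hα : α ≠ 0) (h : ∀ W, α ∣ β * W → α ∣ W) : IsRelPrime α β := by
  intro d hdα hdβ
  obtain ⟨a', rfl⟩ := hdα
  obtain ⟨b', rfl⟩ := hdβ
  obtain ⟨c, hc⟩ : d * a' ∣ a' := h a' ⟨b', by ring⟩
  have ha' : a' ≠ 0 := right_ne_zero_of_mul hα
  have h1 : a' * (d * c) = a' * 1 := by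
    rw [mul_one]
    conv_rhs => rw [hc]
    ring
  exact isUnit_of_dvd_one ⟨c, (mul_left_cancel₀ ha' h1).symm⟩

/-- **Relatively prime polynomials stay relatively prime under `X_i ↦ X_i ^ e`.**
For a field `k`, `e > 0` and `P Q : MvPolynomial (Fin p) k` with `IsRelPrime P Q`, the
expanded polynomials `expand e P`, `expand e Q` are again relatively prime.  (The hypotheses
`IsAlgClosed k` and `CharZero k` are part of the registered signature but are not used.) -/
theorem stub_caseII_expandCoprime {k : Type} [Field k] [IsAlgClosed k] [CharZero k] {p e : ℕ}
    (he : 0 < e) {P Q : MvPolynomial (Fin p) k} (h : IsRelPrime P Q) :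
    IsRelPrime (MvPolynomial.expand e P) (MvPolynomial.expand e Q) := by
  by_cases hP : P = 0
  · subst hP
    rw [map_zero]
    exact isRelPrime_zero_left.mpr ((isRelPrime_zero_left.mp h).map _)
  refine expandCoprime_isRelPrime_of_forall_dvd ((expand_ne_zero he).mpr hP) fun W hW => ?_
  exact expandCoprime_expand_dvd he (fun v hv => h.dvd_of_dvd_mul_left hv) W hW

end Summit.Schanuel.Schanuel.Theorems.RigidCore
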